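import Summits.Parity.GeneralizedHardyLittlewood.Theorems.LiouvilleShiftedTablesPairsToGHLStubRungAtomsAux3
import Summits.Parity.GeneralizedHardyLittlewood.Theorems.LiouvilleShiftedTablesPairsToGHLStubSlopedEulerAux3

/-!
# Sloped ladder, rung — the atoms piece `stub_rungAtomsPart`

Route `LiouvilleShiftedTables` (Parity / GeneralizedHardyLittlewood), crux stmt-Parity-9389 (`PairsToGHL`),
line `sloped_ladder` (Cruxes/PairsToGHL/Lines/sloped_ladder.lean), registered stub `stub_rungAtomsPart`
(lead reshape #2).  In Bombieri's asymptotic-sieve rung for the adjoined form `ψ(n) = a n + b` against the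
tuple weight `F_Φ(n) = ∏ᵢ Λ(aᵢ n + bᵢ)`, the ATOMS piece is the part of
`Σ_{n ≤ N} Λ(ψ(n)) F_Φ(n) = Σ_n F_Φ(n) Σ_{de = ψ(n)} μ(d) log e` with cofactor `e ≤ M₀ = ⌊N^{ε₁}⌋`.
This file proves it is `o(N)` for `ε₁ := min(ε₀/4, 1/8)` from the one-Liouville-factor atoms hypothesis
(the `(Φ, ψ)`-instance of `stub_slopedAtoms`), assembling parts 1–4:
`μ(m/e) = λ(m)λ(e) Σ_{ej² ∣ m} μ(j)` (part 1), `A(N) = Σ_e log e · T_e(N)`, `T_e = λ(e) Σ_j μ(j) U_{ej²}`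
(part 2), tail `j > J = ⌊(log N)^{t+4}⌋` trivially and main part `j ≤ J` by one class per modulus and the
atoms hypothesis at level `N^{ε₀} ≥ M₀ J²` with `A = t + 7` (part 3), and the numerical endgame below.

* `endgame_bound`, `endgame_le` — the numerical endgame: with `L = log N ≥ 1`, `0 ≤ log M₀ ≤ L`,
  `J ≤ L^{t+4} ≤ J+1`, `F_max ≤ (2L)^t`, `B = C N/L^{t+7}`, the abstract bound of part 3 is
  `≤ (τ C + 2^{t+2}(a+b)) N/L² ≤ η N` once `L² ≥ (τ C + 2^{t+2}(a+b))/η`;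
* `eventually_params` — eventually `⌊N^{ε₁}⌋ ⌊(log N)^{t+4}⌋² ≤ ⌊N^{ε₀}⌋`, `⌊N^{ε₁}⌋ ≤ N`, `3 ≤ N`;
* `tupleWeight_le_log_pow` — `F_Φ(n) ≤ (log(C₀ N))^t` on `[1, N]`, `C₀ = 1 + Σᵢ (aᵢ + bᵢ)`;
* `stub_rungAtomsPart` — the registered stub.

Sources: E. Bombieri, *The asymptotic sieve*, Rend. Accad. Naz. XL (5) 1/2 (1975/76), 243–269, §4;
J. Lichtman, *Averages of the Möbius function on shifted primes*, Q. J. Math. 73 (2022), §2. [folklore]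
-/

open Finset Filter

namespace Summit.Parity.GeneralizedHardyLittlewood.Theorems.PairsToGHL.SlopedLadder

namespace RungAtoms

open Literature.NumberTheory.Sieve
open scoped ArithmeticFunction.Moebius ArithmeticFunction.vonMangoldt

variable {t : ℕ}

/-! ### The endgame inequality -/

/-- **Endgame.** See the module docstring. [folklore] -/
theorem endgame_bound {L lM Jr Fb B C τ ab N : ℝ} (hL : 1 ≤ L) (hlM0 : 0 ≤ lM) (hlM : lM ≤ L)
    (hJr0 : 0 ≤ Jr) (hJr : Jr ≤ L ^ (t + 4)) (hJr' : L ^ (t + 4) ≤ Jr + 1) (hFb0 : 0 ≤ Fb)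
    (hFb : Fb ≤ (2 * L) ^ t) (hτ : 0 ≤ τ) (hab : 0 ≤ ab) (hN : 0 ≤ N) (hB0 : 0 ≤ B)
    (hB : B = C * N / L ^ (t + 7)) :
    lM * (Jr * τ * B) + lM * (Fb * (ab * N) * (1 + lM) * (2 / (Jr + 1))) ≤
      (τ * C + 2 ^ (t + 2) * ab) * N / L ^ 2 := by
  have hL0 : 0 < L := by linarith
  have hLpow : ∀ k : ℕ, 0 < L ^ k := fun k => pow_pos hL0 k
  -- `C ≥ 0` from `B ≥ 0`
  have hC0 : 0 ≤ C * N := by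
    have : 0 ≤ C * N / L ^ (t + 7) := hB ▸ hB0
    rwa [le_div_iff₀ (hLpow _), zero_mul] at this
  -- first term
  have h1 : lM * (Jr * τ * B) ≤ τ * C * N / L ^ 2 := by
    calc lM * (Jr * τ * B) ≤ L * (L ^ (t + 4) * τ * B) := by
          gcongr
      _ = τ * (C * N) * (L ^ (t + 5) / L ^ (t + 7)) := by rw [hB]; ring
      _ = τ * (C * N) * (1 / L ^ 2) := by
          congr 1
          rw [div_eq_div_iff (hLpow _).ne' (hLpow _).ne', one_mul, ← pow_add]
      _ = τ * C * N / L ^ 2 := by ring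
  -- second term
  have h2 : lM * (Fb * (ab * N) * (1 + lM) * (2 / (Jr + 1))) ≤ 2 ^ (t + 2) * ab * N / L ^ 2 := by
    have hJ1 : 0 < Jr + 1 := by linarith
    have hfrac : 2 / (Jr + 1) ≤ 2 / L ^ (t + 4) :=
      div_le_div_of_nonneg_left (by norm_num) (hLpow _) hJr'
    calc lM * (Fb * (ab * N) * (1 + lM) * (2 / (Jr + 1)))
        ≤ L * ((2 * L) ^ t * (ab * N) * (1 + L) * (2 / L ^ (t + 4))) := by
          gcongr
      _ ≤ L * ((2 * L) ^ t * (ab * N) * (2 * L) * (2 / L ^ (t + 4))) := by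
          gcongr
          linarith
      _ = 2 ^ (t + 2) * ab * N * (L ^ (t + 2) / L ^ (t + 4)) := by rw [mul_pow]; ring
      _ = 2 ^ (t + 2) * ab * N * (1 / L ^ 2) := by
          congr 1
          rw [div_eq_div_iff (hLpow _).ne' (hLpow _).ne', one_mul, ← pow_add]
      _ = 2 ^ (t + 2) * ab * N / L ^ 2 := by ring
  calc lM * (Jr * τ * B) + lM * (Fb * (ab * N) * (1 + lM) * (2 / (Jr + 1)))
      ≤ τ * C * N / L ^ 2 + 2 ^ (t + 2) * ab * N / L ^ 2 := add_le_add h1 h2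
    _ = (τ * C + 2 ^ (t + 2) * ab) * N / L ^ 2 := by ring

/-- **Endgame, `≤ η N` form.** [folklore] -/
theorem endgame_le {L lM Jr Fb B C τ ab N η : ℝ} (hL : 1 ≤ L) (hlM0 : 0 ≤ lM) (hlM : lM ≤ L)
    (hJr0 : 0 ≤ Jr) (hJr : Jr ≤ L ^ (t + 4)) (hJr' : L ^ (t + 4) ≤ Jr + 1) (hFb0 : 0 ≤ Fb)
    (hFb : Fb ≤ (2 * L) ^ t) (hτ : 0 ≤ τ) (hab : 0 ≤ ab) (hN : 0 ≤ N) (hB0 : 0 ≤ B)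
    (hB : B = C * N / L ^ (t + 7)) (hη : 0 < η) (hLη : (τ * C + 2 ^ (t + 2) * ab) / η ≤ L ^ 2) :
    lM * (Jr * τ * B) + lM * (Fb * (ab * N) * (1 + lM) * (2 / (Jr + 1))) ≤ η * N := by
  have hL0 : 0 < L := by linarith
  refine (endgame_bound hL hlM0 hlM hJr0 hJr hJr' hFb0 hFb hτ hab hN hB0 hB).trans ?_
  rw [div_le_iff₀ hη] at hLη
  rw [div_le_iff₀ (pow_pos hL0 2)]
  calc (τ * C + 2 ^ (t + 2) * ab) * N ≤ (L ^ 2 * η) * N := mul_le_mul_of_nonneg_right hLη hN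
    _ = η * N * L ^ 2 := by ring

/-! ### Eventual parameter inequalities -/

/-- Powers of `log N` are eventually below any positive power of `N` (natural `N`). [folklore] -/
theorem eventually_log_pow_le_rpow (k : ℕ) {δ : ℝ} (hδ : 0 < δ) :
    ∀ᶠ N : ℕ in atTop, Real.log N ^ k ≤ (N : ℝ) ^ δ := by
  have h := (isLittleO_log_rpow_rpow_atTop (k : ℝ) hδ).comp_tendsto tendsto_natCast_atTop_atTop
  filter_upwards [h.eventuallyLE, eventually_ge_atTop 1] with N hN hN1
  simp only [Function.comp, Real.norm_eq_abs] at hN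
  have hlog : 0 ≤ Real.log N := Real.log_nonneg (by exact_mod_cast hN1)
  rw [Real.rpow_natCast, abs_of_nonneg (pow_nonneg hlog k),
    abs_of_nonneg (Real.rpow_nonneg (Nat.cast_nonneg N) δ)] at hN
  exact hN

/-- **Eventually the parameters fit.** For `0 < ε₁ ≤ 1`, `4 ε₁ ≤ ε₀`: eventually in `N`,
`⌊N^{ε₁}⌋ ⌊(log N)^{t+4}⌋² ≤ ⌊N^{ε₀}⌋`, `⌊N^{ε₁}⌋ ≤ N` and `3 ≤ N`. [folklore] -/
theorem eventually_params (t : ℕ) {ε₀ ε₁ : ℝ} (hε₁ : 0 < ε₁) (hε₁1 : ε₁ ≤ 1) (hε : 4 * ε₁ ≤ ε₀) :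
    ∀ᶠ N : ℕ in atTop, ⌊(N : ℝ) ^ ε₁⌋₊ * ⌊Real.log N ^ (t + 4)⌋₊ ^ 2 ≤ ⌊(N : ℝ) ^ ε₀⌋₊ ∧
      ⌊(N : ℝ) ^ ε₁⌋₊ ≤ N ∧ 3 ≤ N := by
  have hε₀ : 0 < ε₀ := by linarith
  have h2 : ∀ᶠ N : ℕ in atTop, (2 : ℝ) ≤ (N : ℝ) ^ (ε₀ / 4) :=
    ((tendsto_rpow_atTop (by positivity)).comp tendsto_natCast_atTop_atTop).eventually_ge_atTop 2
  filter_upwards [eventually_log_pow_le_rpow (2 * (t + 4)) (half_pos hε₀), h2, eventually_ge_atTop 3]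
    with N hlog h2N hN3
  have hN1 : (1 : ℝ) ≤ N := by exact_mod_cast (show 1 ≤ N by omega)
  have hN0 : (0 : ℝ) < N := by linarith
  refine ⟨?_, ?_, hN3⟩
  · -- `M₀ J² ≤ N^{ε₁} (log N)^{2t+8} ≤ N^{ε₁ + ε₀/2} ≤ N^{ε₀} - 1 ≤ ⌊N^{ε₀}⌋`
    have hM : (⌊(N : ℝ) ^ ε₁⌋₊ : ℝ) ≤ (N : ℝ) ^ ε₁ := Nat.floor_le (Real.rpow_nonneg hN0.le _)
    have hlog0 : 0 ≤ Real.log N := Real.log_nonneg hN1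
    have hJ : (⌊Real.log N ^ (t + 4)⌋₊ : ℝ) ≤ Real.log N ^ (t + 4) := Nat.floor_le (pow_nonneg hlog0 _)
    have key : (⌊(N : ℝ) ^ ε₁⌋₊ : ℝ) * (⌊Real.log N ^ (t + 4)⌋₊ : ℝ) ^ 2 ≤ (N : ℝ) ^ ε₀ - 1 := by
      calc (⌊(N : ℝ) ^ ε₁⌋₊ : ℝ) * (⌊Real.log N ^ (t + 4)⌋₊ : ℝ) ^ 2
          ≤ (N : ℝ) ^ ε₁ * (Real.log N ^ (t + 4)) ^ 2 := by gcongr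
        _ = (N : ℝ) ^ ε₁ * Real.log N ^ (2 * (t + 4)) := by ring
        _ ≤ (N : ℝ) ^ ε₁ * (N : ℝ) ^ (ε₀ / 2) := by gcongr
        _ = (N : ℝ) ^ (ε₁ + ε₀ / 2) := by rw [← Real.rpow_add hN0]
        _ ≤ (N : ℝ) ^ (3 * ε₀ / 4) := Real.rpow_le_rpow_of_exponent_le hN1 (by linarith)
        _ ≤ (N : ℝ) ^ ε₀ - 1 := by
            -- `2 N^{3ε₀/4} ≤ N^{ε₀/4} N^{3ε₀/4} = N^{ε₀}` and `1 ≤ N^{3ε₀/4}`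
            have h34 : (1 : ℝ) ≤ (N : ℝ) ^ (3 * ε₀ / 4) := Real.one_le_rpow hN1 (by positivity)
            have hprod : (N : ℝ) ^ (ε₀ / 4) * (N : ℝ) ^ (3 * ε₀ / 4) = (N : ℝ) ^ ε₀ := by
              rw [← Real.rpow_add hN0]; ring_nf
            nlinarith [Real.rpow_nonneg hN0.le (3 * ε₀ / 4)]
    have hfl : (N : ℝ) ^ ε₀ - 1 ≤ (⌊(N : ℝ) ^ ε₀⌋₊ : ℝ) := by
      have := Nat.lt_floor_add_one ((N : ℝ) ^ ε₀)
      linarith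
    exact_mod_cast key.trans hfl
  · have hM : (⌊(N : ℝ) ^ ε₁⌋₊ : ℝ) ≤ (N : ℝ) ^ ε₁ := Nat.floor_le (Real.rpow_nonneg hN0.le _)
    have : (N : ℝ) ^ ε₁ ≤ (N : ℝ) ^ (1 : ℝ) := Real.rpow_le_rpow_of_exponent_le hN1 hε₁1
    rw [Real.rpow_one] at this
    exact_mod_cast hM.trans this


/-- **Pointwise bound for the tuple weight.** For a positive system (`aᵢ ≥ 1`, `bᵢ ≥ 0`) and
`1 ≤ n ≤ N`: `∏ᵢ Λ(aᵢ n + bᵢ) ≤ (log (C₀ N))^t` with `C₀ = 1 + Σᵢ (aᵢ + bᵢ)`. [folklore] -/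
theorem tupleWeight_le_log_pow (Φ : Fin t → AffLinForm 1) (hΦ : ∀ i, 0 < (Φ i).coeff 0 ∧ 0 ≤ (Φ i).const)
    {N n : ℕ} (hn : n ∈ Icc 1 N) :
    ∏ i, intVonMangoldt ((Φ i).eval ![(n : ℤ)]) ≤
      Real.log (((∑ i, (((Φ i).coeff 0).toNat + ((Φ i).const).toNat) + 1 : ℕ) : ℝ) * N) ^ t := by
  set C₀ : ℕ := ∑ i, (((Φ i).coeff 0).toNat + ((Φ i).const).toNat) + 1 with hC₀
  obtain ⟨hn1, hnN⟩ := Finset.mem_Icc.mp hn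
  have hN1 : 1 ≤ N := hn1.trans hnN
  have hC₀1 : 1 ≤ C₀ := by omega
  have hCN : (1 : ℝ) ≤ (C₀ : ℝ) * N := by
    have : (1 : ℝ) ≤ ((C₀ * N : ℕ) : ℝ) := by exact_mod_cast Nat.one_le_iff_ne_zero.mpr (Nat.mul_ne_zero (by omega) (by omega))
    push_cast at this
    exact this
  have hlog0 : 0 ≤ Real.log ((C₀ : ℝ) * N) := Real.log_nonneg hCN
  -- per factor
  have hfac : ∀ i, 0 ≤ intVonMangoldt ((Φ i).eval ![(n : ℤ)]) ∧
      intVonMangoldt ((Φ i).eval ![(n : ℤ)]) ≤ Real.log ((C₀ : ℝ) * N) := by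
    intro i
    refine ⟨ArithmeticFunction.vonMangoldt_nonneg, ?_⟩
    unfold intVonMangoldt
    refine ArithmeticFunction.vonMangoldt_le_log.trans ?_
    -- `(aᵢ n + bᵢ).toNat ≤ C₀ N`
    set z : ℤ := (Φ i).eval ![(n : ℤ)] with hz
    have hz' : z = (((Φ i).coeff 0).toNat * n + ((Φ i).const).toNat : ℕ) := by
      rw [hz, eval_vecSingle]
      push_cast
      rw [Int.toNat_of_nonneg (hΦ i).1.le, Int.toNat_of_nonneg (hΦ i).2]
    have hzn : z.toNat = ((Φ i).coeff 0).toNat * n + ((Φ i).const).toNat := by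
      rw [hz', Int.toNat_natCast]
    have hle : z.toNat ≤ C₀ * N := by
      rw [hzn]
      have h1 : ((Φ i).coeff 0).toNat + ((Φ i).const).toNat ≤ C₀ := by
        have := Finset.single_le_sum (f := fun j => ((Φ j).coeff 0).toNat + ((Φ j).const).toNat)
          (fun j _ => Nat.zero_le _) (Finset.mem_univ i)
        omega
      calc ((Φ i).coeff 0).toNat * n + ((Φ i).const).toNat
          ≤ ((Φ i).coeff 0).toNat * N + ((Φ i).const).toNat * N :=
            Nat.add_le_add (Nat.mul_le_mul_left _ hnN) (Nat.le_mul_of_pos_right _ (by omega))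
        _ = (((Φ i).coeff 0).toNat + ((Φ i).const).toNat) * N := by ring
        _ ≤ C₀ * N := Nat.mul_le_mul_right _ h1
    rcases Nat.eq_zero_or_pos z.toNat with h0 | hpos
    · rw [h0, Nat.cast_zero, Real.log_zero]
      exact hlog0
    · refine Real.log_le_log (by exact_mod_cast hpos) ?_
      exact_mod_cast hle
  calc ∏ i, intVonMangoldt ((Φ i).eval ![(n : ℤ)]) ≤ ∏ _i : Fin t, Real.log ((C₀ : ℝ) * N) :=
        Finset.prod_le_prod (fun i _ => (hfac i).1) fun i _ => (hfac i).2
    _ = Real.log ((C₀ : ℝ) * N) ^ t := by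
        rw [Finset.prod_const, Finset.card_univ, Fintype.card_fin]

end RungAtoms

open Literature.NumberTheory.Sieve in
open scoped ArithmeticFunction.Moebius in
/-- **Registered stub `stub_rungAtomsPart` of line `sloped_ladder` (crux `PairsToGHL`, stmt-Parity-9389).**
The atoms piece of Bombieri's asymptotic-sieve rung is `o(N)`: for a positive `t`-system `Φ` and a positive
adjoined form `ψ` with `vecCons ψ Φ` non-degenerate, the one-Liouville-factor atoms hypothesis (level `N^{ε₀}`,
one class and one height per modulus, every `A`) gives `ε₁ := min(ε₀/4, 1/8)` such that for every `η > 0`,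
eventually `|Σ_{n ≤ N} F_Φ(n) Σ_{(d,e): de = ψ(n), e ≤ ⌊N^{ε₁}⌋} μ(d) log e| ≤ η N`.  See the module docstring
for the proof. [cite: BombieriAsymptoticSieve1976, §4] -/
theorem stub_rungAtomsPart :
    ∀ t : ℕ, 1 ≤ t → ∀ (Φ : Fin t → Literature.NumberTheory.Sieve.AffLinForm 1) (ψ : Literature.NumberTheory.Sieve.AffLinForm 1), Literature.NumberTheory.Sieve.IsNondegenerateSystem (Matrix.vecCons ψ Φ) → (∀ i, 0 < (Φ i).coeff 0 ∧ 0 ≤ (Φ i).const) → (0 < ψ.coeff 0 ∧ 0 ≤ ψ.const) → (∃ ε₀ : ℝ, 0 < ε₀ ∧ ∀ A : ℝ, 0 < A → ∃ C : ℝ, ∃ N₀ : ℕ, ∀ N : ℕ, N₀ ≤ N → ∀ w y : ℕ → ℕ, (∀ q, y q ≤ N) → (∑ q ∈ Finset.Icc 1 ⌊(N : ℝ) ^ ε₀⌋₊, |∑ n ∈ (Finset.Icc 1 (y q)).filter (fun n : ℕ => n ≡ w q [MOD q]), (ArithmeticFunction.liouville (Int.toNat (ψ.eval ![(n : ℤ)]))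 : ℝ) * ∏ i, Literature.NumberTheory.Sieve.intVonMangoldt ((Φ i).eval ![(n : ℤ)])|) ≤ C * N / Real.log N ^ A) → ∃ ε₁ : ℝ, 0 < ε₁ ∧ ε₁ ≤ 1 / 8 ∧ ∀ η : ℝ, 0 < η → ∃ N₀ : ℕ, ∀ N : ℕ, N₀ ≤ N → |∑ n ∈ Finset.Icc 1 N, (∏ i, Literature.NumberTheory.Sieve.intVonMangoldt ((Φ i).eval ![(n : ℤ)])) * ∑ x ∈ (Nat.divisorsAntidiagonal (Int.toNat (ψ.eval ![(n : ℤ)]))).filter (fun x : ℕ × ℕ => x.2 ≤ ⌊(N : ℝ) ^ ε₁⌋₊), (ArithmeticFunction.moebius x.1 : ℝ) * Real.log x.2| ≤ η * N := by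
  intro t _ht Φ ψ _hnd hΦ hψ hAt
  obtain ⟨ε₀, hε₀, hAt⟩ := hAt
  obtain ⟨hψa, hψb⟩ := hψ
  -- the data of `ψ` as natural numbers
  set a : ℕ := (ψ.coeff 0).toNat with ha_def
  set b : ℕ := (ψ.const).toNat with hb_def
  have ha : 0 < a := by
    rw [ha_def]
    omega
  have hm : ∀ n : ℕ, Int.toNat (ψ.eval ![(n : ℤ)]) = a * n + b := by
    intro n
    have : ψ.eval ![(n : ℤ)] = ((a * n + b : ℕ) : ℤ) := by
      rw [eval_vecSingle]
      push_cast
      rw [ha_def, hb_def, Int.toNat_of_nonneg hψa.le, Int.toNat_of_nonneg hψb]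
    rw [this, Int.toNat_natCast]
  -- constants
  set C₀ : ℕ := ∑ i, (((Φ i).coeff 0).toNat + ((Φ i).const).toNat) + 1 with hC₀
  set τ : ℕ := #(Nat.divisors a) with hτ
  -- the exponent
  set ε₁ : ℝ := min (ε₀ / 4) (1 / 8) with hε₁
  have hε₁0 : 0 < ε₁ := lt_min (by positivity) (by norm_num)
  have hε₁8 : ε₁ ≤ 1 / 8 := min_le_right _ _
  have hε₁4 : 4 * ε₁ ≤ ε₀ := by
    have := min_le_left (ε₀ / 4) (1 / 8)
    linarith
  refine ⟨ε₁, hε₁0, hε₁8, fun η hη => ?_⟩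
  -- the atoms input at `A = t + 7`
  obtain ⟨C, N_A, hCA⟩ := hAt ((t : ℝ) + 7) (by positivity)
  set K : ℝ := (τ : ℝ) * C + 2 ^ (t + 2) * ((a + b : ℕ) : ℝ) with hK
  -- eventual conditions
  have hev1 := RungAtoms.eventually_params t hε₁0 (by linarith) hε₁4
  have hev2 : ∀ᶠ N : ℕ in atTop, K / η ≤ Real.log N ^ 2 ∧ (C₀ : ℝ) ≤ N ∧ N_A ≤ N := by
    have hlog : Tendsto (fun N : ℕ => Real.log N) atTop atTop :=
      Real.tendsto_log_atTop.comp tendsto_natCast_atTop_atTop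
    filter_upwards [hlog.eventually_ge_atTop (max 1 (K / η)), tendsto_natCast_atTop_atTop.eventually_ge_atTop
      (C₀ : ℝ), eventually_ge_atTop N_A] with N hN hC hA
    refine ⟨?_, hC, hA⟩
    have h1 : 1 ≤ Real.log N := le_trans (le_max_left _ _) hN
    have h2 : K / η ≤ Real.log N := le_trans (le_max_right _ _) hN
    nlinarith
  obtain ⟨N₀, hN₀⟩ := Filter.eventually_atTop.mp (hev1.and hev2)
  refine ⟨N₀, fun N hN => ?_⟩
  obtain ⟨⟨hQ, hM₀N, hN3⟩, hLη, hC₀N, hNA⟩ := hN₀ N hN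
  -- abbreviations
  set M₀ : ℕ := ⌊(N : ℝ) ^ ε₁⌋₊ with hM₀
  set L : ℝ := Real.log N with hL
  set J : ℕ := ⌊L ^ (t + 4)⌋₊ with hJ
  set Q : ℕ := ⌊(N : ℝ) ^ ε₀⌋₊ with hQdef
  set F : ℕ → ℝ := fun n => ∏ i, Literature.NumberTheory.Sieve.intVonMangoldt ((Φ i).eval ![(n : ℤ)])
    with hFdef
  have hN1 : 1 ≤ N := by omega
  have hNr : (1 : ℝ) ≤ N := by exact_mod_cast hN1
  have hL1 : 1 ≤ L := by
    rw [hL, Real.le_log_iff_exp_le (by exact_mod_cast (show 0 < N by omega))]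
    have h3 : (3 : ℝ) ≤ N := by exact_mod_cast hN3
    have := Real.exp_one_lt_d9
    linarith
  have hL0 : 0 < L := by linarith
  -- rewrite the inner sums
  have hinner : ∀ n ∈ Icc 1 N,
      (∏ i, Literature.NumberTheory.Sieve.intVonMangoldt ((Φ i).eval ![(n : ℤ)])) *
        ∑ x ∈ (Nat.divisorsAntidiagonal (Int.toNat (ψ.eval ![(n : ℤ)]))).filter
          (fun x : ℕ × ℕ => x.2 ≤ M₀), ((μ x.1 : ℤ) : ℝ) * Real.log x.2 =
      F n * ∑ e ∈ (Icc 1 M₀).filter (fun e : ℕ => e ∣ a * n + b),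
          ((μ ((a * n + b) / e) : ℤ) : ℝ) * Real.log e := by
    intro n hn
    have hn1 : 1 ≤ n := (Finset.mem_Icc.mp hn).1
    have hk : a * n + b ≠ 0 := by
      have : 1 ≤ a * n := Nat.one_le_iff_ne_zero.mpr (Nat.mul_ne_zero ha.ne' (by omega))
      omega
    rw [hm n, RungAtoms.inner_atoms_eq hk M₀]
  rw [Finset.sum_congr rfl hinner]
  -- the weight bounds
  have hF0 : ∀ n, 0 ≤ F n := fun n =>
    Finset.prod_nonneg fun i _ => ArithmeticFunction.vonMangoldt_nonneg
  set Fb : ℝ := Real.log ((C₀ : ℝ) * N) ^ t with hFbdef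
  have hCN : (1 : ℝ) ≤ (C₀ : ℝ) * N := by
    have hC1 : (1 : ℝ) ≤ C₀ := by exact_mod_cast (show 1 ≤ C₀ by omega)
    nlinarith
  have hFb0 : 0 ≤ Fb := pow_nonneg (Real.log_nonneg hCN) t
  have hFb : ∀ n ∈ Icc 1 N, F n ≤ Fb := fun n hn => RungAtoms.tupleWeight_le_log_pow Φ hΦ hn
  have hFbL : Fb ≤ (2 * L) ^ t := by
    refine pow_le_pow_left₀ (Real.log_nonneg hCN) ?_ t
    have hC₀0 : (0 : ℝ) < C₀ := by exact_mod_cast (show 0 < C₀ by omega)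
    rw [Real.log_mul hC₀0.ne' (by positivity), two_mul]
    exact add_le_add ((Real.log_le_log hC₀0 hC₀N).trans hL.symm.le) hL.symm.le
  -- the one-class bound from the atoms hypothesis, at height `y ≡ N`
  set B : ℝ := C * N / L ^ (t + 7) with hBdef
  have hB : ∀ w : ℕ → ℕ, ∑ q ∈ Icc 1 Q, |∑ n ∈ (Icc 1 N).filter (fun n : ℕ => n ≡ w q [MOD q]),
      ((ArithmeticFunction.liouville (a * n + b) : ℤ) : ℝ) * F n| ≤ B := by
    intro w
    have h := hCA N hNA w (fun _ => N) (fun _ => le_rfl)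
    simp only [hm] at h
    have hpow : Real.log N ^ ((t : ℝ) + 7) = L ^ (t + 7) := by
      rw [hL, ← Real.rpow_natCast]
      push_cast
      ring_nf
    rw [hpow] at h
    exact h
  have hB0 : 0 ≤ B := le_trans (Finset.sum_nonneg fun q _ => abs_nonneg _) (hB fun _ => 0)
  -- the abstract bound
  have hJJ' : J ≤ max J ((a + b) * N) := le_max_left _ _
  have hJ' : (a + b) * N ≤ max J ((a + b) * N) := le_max_right _ _
  have habs := RungAtoms.atoms_abs_le ha b hF0 hFb0 hFb hJJ' hJ' hQ hB
  refine habs.trans ?_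
  -- numerical endgame
  have hlM0 : 0 ≤ Real.log M₀ := Real.log_natCast_nonneg M₀
  have hlM : Real.log M₀ ≤ L := by
    rcases Nat.eq_zero_or_pos M₀ with h0 | hpos
    · rw [h0, Nat.cast_zero, Real.log_zero]; exact hL0.le
    · exact Real.log_le_log (by exact_mod_cast hpos) (by exact_mod_cast hM₀N)
  have hJr : (J : ℝ) ≤ L ^ (t + 4) := Nat.floor_le (pow_nonneg hL0.le _)
  have hJr' : L ^ (t + 4) ≤ (J : ℝ) + 1 := (Nat.lt_floor_add_one _).le
  have hcast : (((a + b) * N : ℕ) : ℝ) = ((a + b : ℕ) : ℝ) * (N : ℝ) := by push_cast; ring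
  rw [hcast]
  exact RungAtoms.endgame_le (t := t) hL1 hlM0 hlM (Nat.cast_nonneg J) hJr hJr' hFb0 hFbL
    (Nat.cast_nonneg τ) (Nat.cast_nonneg (a + b)) (Nat.cast_nonneg N) hB0 rfl hη hLη

end Summit.Parity.GeneralizedHardyLittlewood.Theorems.PairsToGHL.SlopedLadder
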